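import Literature.Geometry.Riemannian.RicciFlowMetricFlowPair
import Literature.Geometry.Riemannian.RicciFlowHConcentrationHolds
import Literature.Geometry.Riemannian.MetricFlowHCenters
import HarnessLib

/-!
# The metric flow pair of a compact Ricci flow is `H_m`-concentrated with vanishing final
# variance (Bamler 2023, §7.1, Lemma 7.3 / arXiv v1 Lemma 154)

R. Bamler, *Compactness theory of the space of super Ricci flows*, Invent. Math. 233 (2023), §7.1,
Lemma (arXiv v1 Lemma 154): the pair of (the metric flow of) a super Ricci flow on a compact
`n`-manifold with a conjugate heat kernel measure `ν_{x₀;s} = K(x₀, t_max; ·, s) dg_s` lies in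
`𝔽^{*,J}_I(H_n) = 𝔽^J_I(H_n, 0, b, r)`, i.e. (Def. 7.1 / arXiv v1 Def. 152) its flow is
`H_n`-concentrated and (case (2b), `t_max ∉ J`) `limsup_{t ↗ t_max} Var(μ_t) ≤ 0`. For the tree's
`ricciFlowMetricFlowPair` (I = [a, T], I' = (a, T), `μ_s = ν_{x₀,T;s}`) we prove exactly these two
properties: `ricciFlowMetricFlowPair_isHConcentrated` (from `ricciFlowMetricFlow_isHConcentrated`,
Bamler 2020a Cor. 3.7) and `variance_ricciFlowMetricFlowPair_measure_le` (`Var(ν_{x₀,T;s}) ≤ H_m (T − s)`,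
the `H_m`-concentration of the flow over `[a, T]` at the base point), whence the final variance
tends to `0` (`tendsto_variance_ricciFlowMetricFlowPair_measure`). Everything is proved; no named facts.

## References

* R. H. Bamler, *Compactness theory of the space of super Ricci flows*, Invent. Math. 233 (2023),
  1121–1277, §7.1, Def. 7.1 and Lemma 7.3 (arXiv v1 Def. 152, Lemma 154). [Bamler2023]
* R. H. Bamler, *Entropy and heat kernel bounds on a Ricci flow background*, arXiv:2008.07093
  (2020), §3.1, Cor. 3.7. [Bamler2020Entropy]
-/

noncomputable section

open Set MeasureTheory Filter TopologicalSpace Function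
open scoped Manifold ContDiff Topology ENNReal NNReal

namespace Literature.Geometry.Riemannian

open Lorentzian Lorentzian.PseudoRiemannianMetric

universe u

variable {m : ℕ} {H : Type*} [TopologicalSpace H]
  {I : ModelWithCorners ℝ (EuclideanSpace ℝ (Fin m)) H} [I.Boundaryless]
  {M : Type u} [TopologicalSpace M] [ChartedSpace H M] [IsManifold I ∞ M]
  [T2Space M] [CompactSpace M] [SecondCountableTopology M] [MeasurableSpace M] [BorelSpace M]
  [ConnectedSpace M]
  {h : ℝ → PseudoRiemannianMetric I ∞ (EuclideanSpace ℝ (Fin m)) (TangentSpace I : M → Type _)}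
  {cov : ℝ → CovariantDerivative I (EuclideanSpace ℝ (Fin m)) (TangentSpace I : M → Type _)}
  {a T : ℝ}

/-- **The flow of the pair is `H_m`-concentrated** (Bamler 2023, Lemma 7.3 with Def. 7.1 (1);
`H_m = (m − 1)π²/2 + 4`, Bamler 2020a Cor. 3.7 for the flow restricted to `(a, T)`).
[cite: Bamler2023, §7.1, Lemma 7.3; Def. 7.1] [cite: Bamler2020Entropy, §3.1, Cor. 3.7] -/
theorem ricciFlowMetricFlowPair_isHConcentrated (hm : 0 < m) (hflow : IsRicciFlow h cov (Icc a T))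
    (hh : IsContMDiffFamilyOn ∞ h univ) (hR : ∀ r, (h r).IsRiemannian) (haT : a < T) (x₀ : M) :
    (ricciFlowMetricFlowPair hh hR hflow haT x₀).flow.IsHConcentrated
      (MetricFlow.concentrationConst m) :=
  ricciFlowMetricFlow_isHConcentrated hm hh hR Set.ordConnected_Ioo (hflow.mono Ioo_subset_Icc_self)

/-- **The variance of the measures of the pair is at most `H_m (T − s)`** (Bamler 2023,
Lemma 7.3 with Def. 7.1 (2b): `Var(ν_{x₀,T;s}) ≤ H_m (T − s)`, the `H_m`-concentration of the
metric flow over `[a, T]` at the pair `(x₀, x₀)` of the final slice, `d_T(x₀, x₀) = 0`). The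
variance is taken in the `g_s`-distance. [cite: Bamler2023, §7.1, Lemma 7.3; Def. 7.1 (2b)] -/
theorem variance_ricciFlowMetricFlowPair_measure_le (hm : 0 < m) (hflow : IsRicciFlow h cov (Icc a T))
    (hh : IsContMDiffFamilyOn ∞ h univ) (hR : ∀ r, (h r).IsRiemannian) (haT : a < T) (x₀ : M)
    (s : Ioo a T) :
    variance (X := (ricciFlowMetricFlowPair hh hR hflow haT x₀).flow.Slice s)
        ((ricciFlowMetricFlowPair hh hR hflow haT x₀).μ s)
        ((ricciFlowMetricFlowPair hh hR hflow haT x₀).μ s) ≤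
      ENNReal.ofReal (MetricFlow.concentrationConst m * (T - s)) := by
  -- the same measures, seen in the metric flow over `[a, T]` at the base point `(x₀, T)`
  have hH := ricciFlowMetricFlow_isHConcentrated hm hh hR Set.ordConnected_Icc hflow
  have hT : T ∈ Icc a T := ⟨haT.le, le_rfl⟩
  have hs : (s : ℝ) ∈ Icc a T := Ioo_subset_Icc_self s.2
  exact hH.variance_condKernel_self_le_ofReal (s := ⟨s, hs⟩) (t := ⟨T, hT⟩) s.2.2.le x₀

/-- **The final variance of the pair vanishes**: `Var(μ_s) → 0` as `s ↗ T` (Bamler 2023, Def. 7.1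
(2b) with `V = 0`: `limsup_{t ↗ t_max} Var(μ_t) ≤ 0`). Stated along any sequence of times
`s_k ∈ (a, T)` with `s_k → T`. [cite: Bamler2023, §7.1, Lemma 7.3; Def. 7.1 (2b)] -/
theorem tendsto_variance_ricciFlowMetricFlowPair_measure (hm : 0 < m) (hflow : IsRicciFlow h cov (Icc a T))
    (hh : IsContMDiffFamilyOn ∞ h univ) (hR : ∀ r, (h r).IsRiemannian) (haT : a < T) (x₀ : M)
    {sk : ℕ → Ioo a T} (hsk : Tendsto (fun k ↦ ((sk k : ℝ))) atTop (𝓝 T)) :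
    Tendsto (fun k ↦ variance (X := (ricciFlowMetricFlowPair hh hR hflow haT x₀).flow.Slice (sk k))
        ((ricciFlowMetricFlowPair hh hR hflow haT x₀).μ (sk k))
        ((ricciFlowMetricFlowPair hh hR hflow haT x₀).μ (sk k))) atTop (𝓝 0) := by
  -- squeeze between `0` and `H_m (T − s_k) → 0`
  have hb : Tendsto (fun k ↦ ENNReal.ofReal (MetricFlow.concentrationConst m * (T - sk k)))
      atTop (𝓝 0) := by
    rw [← ENNReal.ofReal_zero]
    refine ENNReal.tendsto_ofReal ?_
    have h1 : Tendsto (fun k ↦ T - (sk k : ℝ)) atTop (𝓝 (T - T)) := tendsto_const_nhds.sub hsk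
    rw [sub_self] at h1
    simpa using h1.const_mul (MetricFlow.concentrationConst m)
  exact tendsto_of_tendsto_of_tendsto_of_le_of_le tendsto_const_nhds hb (fun _ ↦ zero_le)
    fun k ↦ variance_ricciFlowMetricFlowPair_measure_le hm hflow hh hR haT x₀ (sk k)

end Literature.Geometry.Riemannian

end
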